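import Summits.CriticalPhenomena.PercolationContinuityZ3.Theorems.Transplant.SiteSetRestrict
import Summits.CriticalPhenomena.PercolationContinuityZ3.Theorems.PercNearOneGluingNoHeavyLowerTailCovTauMetaA2Defs
import HarnessLib

/-!
# SITE percolation: the functionals of the generic two-source inequality META-A2 (WP4 of P1-SITE-Z3 §12, definitions)
# (lane `prim-bschramm`, class C1a; site twin of `Theorems/PercNearOneGluingNoHeavyLowerTailCovTauMetaA2Defs.lean`)

builds on p205010 (kernel theorem, internal audit signed; external expert review pending).

Finite weight-sum framework (`BHK2006.weight q ω`, vertex weights `q : V → ℝ`), site percolation restricted to `U : Finset V`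
(`SiteBHK.sC/sD/sS`, p207743; source SETS `SiteBHK.setC/srest`, `SiteSetRestrict`).  For an avoided SET `A`, observers `o, v`, an owner
`x` and a pure world functional `F : Finset V → ℝ`:
* `Eav q U A o v N = Σ_ω weight·1{o ∈ C^U_v}·1{v ↮ A ∪ N}` (`μ_{G[U]}(o ↔ v, v ↮ A ∪ N)`),  `Mav q U A v N = μ_{G[U]}(v ↮ A ∪ N)`,
  `qav = Eav(∅)/Mav(∅)`;
* `Yw q U x F N = E[F(srest U N) ; x ↮ N]`,  `Xw q U x A o v F N = E[qav(srest U N)·F(srest U N) ; x ↮ N]` — the world is the SITE world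
  `srest` (source set, its clusters and their vertex boundary dead);
* nonnegativity, `Eav ≤ Mav`, antitonicity in the source set, vanishing cases, `Yw ∅ = F U`, `Xw ∅ = qav·F U`;
* the star decompositions at `Z ⊆ N` (conditioning on the vertex STATES of `Z`): `Yw_step`, `Xw_step` (from `SiteBHK.setStep_sum`),
  `Eav_step`, `Mav_step` (from `SiteBHK.step_sum`).
The META-A2 induction itself (`metaA2_of_star`, bond `CovTauMetaA2.lean`) and the antitonicity of `Yw` are the next files of WP4.
Definitions file (`--supports stmt-CriticalPhenomena-4575 --as helper`); no named facts, no sorries.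
[cite: VandenbergHaggstromKahn2005, Thm. 1.1 (pp. 3–5), §1 p. 4 identity (6)] [cite: KozmaNitzan2024, Conj. 1 (p. 3)]
-/

noncomputable section

namespace Summit.CriticalPhenomena.PercolationContinuityZ3.Theorems.Transplant

namespace SiteCovTau

open Literature.Probability.Percolation
open Literature.Probability.Percolation.BHK2006 (weight weight_nonneg sum_ind_mono sum_ind_nonneg ind_le_one ind_mono)
open Literature.Probability.Percolation.DecisionTree (ind ind_of_mem ind_of_not_mem ind_nonneg)
open SiteBHK (sC sD sS setC srest blockE step_sum setStep_sum sD_antitone sC_mono mem_srest srest_empty setC_empty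
  sC_mono_set)
open scoped Classical

variable {V : Type*} {Γ : SimpleGraph V}

/-! ### Avoidance events only see the avoided vertices inside `U` -/

/-- In `G[U]` the cluster of `v` lies inside `U`; two avoided sets that agree on `U` define the same avoidance event. [folklore] -/
theorem sD_eq_of_agree (U : Finset V) (v : V) {X Y : Set V} (h : ∀ a ∈ U, a ∈ X ↔ a ∈ Y) :
    sD Γ U v X = sD Γ U v Y := by
  ext ω
  simp only [sD, Set.mem_setOf_eq]
  constructor
  · intro hX a haY ha
    exact hX a ((h a ha.2.1.2).2 haY) ha
  · intro hY a haX ha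
    exact hY a ((h a ha.2.1.2).1 haX) ha

/-- In particular `{v ↮ X} = {v ↮ X ∩ U}` in `G[U]`. [folklore] -/
theorem sD_inter_coe (U : Finset V) (v : V) (X : Set V) : sD Γ U v (X ∩ ↑U) = sD Γ U v X :=
  sD_eq_of_agree U v fun _ haU => ⟨fun h => h.1, fun h => ⟨h, haU⟩⟩

/-- `1{o ∈ C}` as a (monotone) function of a vertex cluster. [folklore] -/
def oInd (o : V) (C : Set V) : ℝ := ind {C : Set V | o ∈ C} C

/-- `oInd ≥ 0`. [folklore] -/
theorem oInd_nonneg (o : V) (C : Set V) : 0 ≤ oInd o C := ind_nonneg _ _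

/-- `oInd ≤ 1`. [folklore] -/
theorem oInd_le_one (o : V) (C : Set V) : oInd o C ≤ 1 := ind_le_one _ _

/-- `oInd o` is monotone. [folklore] -/
theorem oInd_mono (o : V) : Monotone (oInd o) := fun C C' h => by
  by_cases hC : C ∈ {C : Set V | o ∈ C}
  · simp only [oInd, ind_of_mem hC, ind_of_mem (show C' ∈ {C : Set V | o ∈ C} from h hC)]; exact le_rfl
  · simp only [oInd, ind_of_not_mem hC]; exact ind_nonneg _ _

variable [Fintype V]

variable (Γ)

/-! ### The functionals -/

/-- `E_A(N) = μ_{G[U]}(o ∈ C_v, v ↮ A ∪ N)` (site). [cite: VandenbergHaggstromKahn2005, §1 p. 3] -/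
def Eav (q : V → ℝ) (U : Finset V) (A : Set V) (o v : V) (N : Set V) : ℝ :=
  ∑ ω, weight q ω * (oInd o (sC Γ U v ω) * ind (sD Γ U v (A ∪ N)) ω)

/-- `M_A(N) = μ_{G[U]}(v ↮ A ∪ N)` (site). [cite: VandenbergHaggstromKahn2005, §1 p. 3] -/
def Mav (q : V → ℝ) (U : Finset V) (A : Set V) (v : V) (N : Set V) : ℝ :=
  ∑ ω, weight q ω * ind (sD Γ U v (A ∪ N)) ω

/-- `q_A = E_A(∅)/M_A(∅) = μ_{G[U]}(o ∈ C_v | v ↮ A)` (`0` if `M_A(∅) = 0`). [folklore] -/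
def qav (q : V → ℝ) (U : Finset V) (A : Set V) (o v : V) : ℝ := Eav Γ q U A o v ∅ / Mav Γ q U A v ∅

/-- `Y_F(N) = E[ F(srest U N) ; x ↮ N ]` for a pure world functional `F : Finset V → ℝ` (site world).
[cite: VandenbergHaggstromKahn2005, §1 p. 4] -/
def Yw (q : V → ℝ) (U : Finset V) (x : V) (F : Finset V → ℝ) (N : Set V) : ℝ :=
  ∑ ω, weight q ω * (F (srest Γ U N ω) * ind (sD Γ U x N) ω)

/-- `X_F(N) = E[ q_A(srest U N)·F(srest U N) ; x ↮ N ]` (site world). [cite: VandenbergHaggstromKahn2005, §1 p. 4] -/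
def Xw (q : V → ℝ) (U : Finset V) (x : V) (A : Set V) (o v : V) (F : Finset V → ℝ) (N : Set V) : ℝ :=
  ∑ ω, weight q ω * (qav Γ q (srest Γ U N ω) A o v * F (srest Γ U N ω) * ind (sD Γ U x N) ω)

variable {Γ}

/-! ### Elementary properties -/

section Props

variable {q : V → ℝ} (hq0 : ∀ u, 0 ≤ q u) (hq1 : ∀ u, q u ≤ 1)
include hq0 hq1

/-- `E_A(N) ≥ 0`. [folklore] -/
theorem Eav_nonneg (U : Finset V) (A : Set V) (o v : V) (N : Set V) : 0 ≤ Eav Γ q U A o v N :=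
  sum_ind_nonneg hq0 hq1 (fun _ => oInd_nonneg _ _) _

/-- `M_A(N) ≥ 0`. [folklore] -/
theorem Mav_nonneg (U : Finset V) (A : Set V) (v : V) (N : Set V) : 0 ≤ Mav Γ q U A v N :=
  Finset.sum_nonneg fun ω _ => mul_nonneg (weight_nonneg hq0 hq1 ω) (ind_nonneg _ _)

/-- `E_A(N) ≤ M_A(N)`. [folklore] -/
theorem Eav_le_Mav (U : Finset V) (A : Set V) (o v : V) (N : Set V) : Eav Γ q U A o v N ≤ Mav Γ q U A v N :=
  Finset.sum_le_sum fun ω _ => mul_le_mul_of_nonneg_left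
    (by simpa only [one_mul] using
      mul_le_mul_of_nonneg_right (oInd_le_one o (sC Γ U v ω)) (ind_nonneg (sD Γ U v (A ∪ N)) ω))
    (weight_nonneg hq0 hq1 ω)

/-- `E_A` is antitone in the source set. [folklore] -/
theorem Eav_antitone (U : Finset V) (A : Set V) (o v : V) {N N' : Set V} (h : N ⊆ N') :
    Eav Γ q U A o v N' ≤ Eav Γ q U A o v N :=
  sum_ind_mono hq0 hq1 (fun _ => oInd_nonneg _ _) (sD_antitone (Set.union_subset_union_right A h))

/-- `M_A` is antitone in the source set. [folklore] -/
theorem Mav_antitone (U : Finset V) (A : Set V) (v : V) {N N' : Set V} (h : N ⊆ N') :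
    Mav Γ q U A v N' ≤ Mav Γ q U A v N := by
  have := sum_ind_mono hq0 hq1 (h := fun _ => (1 : ℝ)) (fun _ => zero_le_one)
    (sD_antitone (Γ := Γ) (U := U) (s := v) (Set.union_subset_union_right A h)) (w := q)
  simpa only [Mav, one_mul] using this

/-- `q_A ≥ 0`. [folklore] -/
theorem qav_nonneg (U : Finset V) (A : Set V) (o v : V) : 0 ≤ qav Γ q U A o v :=
  div_nonneg (Eav_nonneg hq0 hq1 U A o v ∅) (Mav_nonneg hq0 hq1 U A v ∅)

/-- `q_A ≤ 1`. [folklore] -/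
theorem qav_le_one (U : Finset V) (A : Set V) (o v : V) : qav Γ q U A o v ≤ 1 :=
  div_le_one_of_le₀ (Eav_le_Mav hq0 hq1 U A o v ∅) (Mav_nonneg hq0 hq1 U A v ∅)

/-- `Y_F(N) ≥ 0` for a nonnegative world functional. [folklore] -/
theorem Yw_nonneg (U : Finset V) (x : V) {F : Finset V → ℝ} (hF0 : ∀ U', 0 ≤ F U') (N : Set V) :
    0 ≤ Yw Γ q U x F N :=
  sum_ind_nonneg hq0 hq1 (fun _ => hF0 _) _

/-- `X_F(N) ≥ 0` for a nonnegative world functional. [folklore] -/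
theorem Xw_nonneg (U : Finset V) (x : V) (A : Set V) (o v : V) {F : Finset V → ℝ} (hF0 : ∀ U', 0 ≤ F U')
    (N : Set V) : 0 ≤ Xw Γ q U x A o v F N :=
  sum_ind_nonneg hq0 hq1 (fun _ => mul_nonneg (qav_nonneg hq0 hq1 _ A o v) (hF0 _)) _

end Props

/-! ### Vanishing cases and the empty source set -/

omit [Fintype V] in
/-- `{v ↮ X} = ∅`-free form: if `v ∈ X` then `v ↮ X` forces `v` CLOSED, so `1{o ∈ C_v} = 0` on the event. [folklore] -/
theorem oInd_mul_ind_eq_zero_of_mem {U : Finset V} {A : Set V} {o v : V} (hv : v ∈ A) (ω : Set V) :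
    oInd o (sC Γ U v ω) * ind (sD Γ U v A) ω = 0 := by
  by_cases h : ω ∈ sD Γ U v A
  · have hvo : v ∉ sC Γ U v ω := h v hv
    have ho : o ∉ sC Γ U v ω := fun ho => hvo ⟨ho.1, ho.1, SimpleGraph.Reachable.refl v⟩
    simp only [oInd, ind_of_not_mem (show sC Γ U v ω ∉ {C : Set V | o ∈ C} from ho), zero_mul]
  · rw [ind_of_not_mem h, mul_zero]

/-- `E_A(N) = 0` when `v ∈ A ∪ N` (on `{v ↮ v}` the observer `v` is closed and `o ∉ C_v = ∅`). [folklore] -/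
theorem Eav_eq_zero_of_mem (q : V → ℝ) (U : Finset V) (A : Set V) (o v : V) {N : Set V}
    (hv : v ∈ A ∪ N) : Eav Γ q U A o v N = 0 :=
  Finset.sum_eq_zero fun ω _ => by rw [oInd_mul_ind_eq_zero_of_mem hv ω, mul_zero]

/-- `Y_F(N) = 0` in `G[U]` when the functional vanishes on every world not containing `v` and `v ∉ U`. [folklore] -/
theorem Yw_eq_zero_of_not_mem (q : V → ℝ) {U : Finset V} (x : V) {v : V} {F : Finset V → ℝ}
    (hFv : ∀ U' : Finset V, v ∉ U' → F U' = 0) (hv : v ∉ U) (N : Set V) : Yw Γ q U x F N = 0 :=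
  Finset.sum_eq_zero fun ω _ => by
    rw [hFv _ (fun h' => hv (SiteBHK.srest_subset U N ω h'))]; ring

/-- `X_F(∅) = q_A·F(U)` (nothing is explored for the empty source set). [folklore] -/
theorem Xw_empty (q : V → ℝ) (hm : ∑ ω, weight q ω = 1) (U : Finset V) (x : V) (A : Set V) (o v : V)
    (F : Finset V → ℝ) : Xw Γ q U x A o v F ∅ = qav Γ q U A o v * F U := by
  unfold Xw
  have h : ∀ ω : Set V, ind (sD Γ U x (∅ : Set V)) ω = 1 := fun ω => ind_of_mem fun _ h => h.elim
  simp only [srest_empty, h, mul_one]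
  rw [← Finset.sum_mul, hm, one_mul]

/-- `Y_F(∅) = F(U)`. [folklore] -/
theorem Yw_empty (q : V → ℝ) (hm : ∑ ω, weight q ω = 1) (U : Finset V) (x : V) (F : Finset V → ℝ) :
    Yw Γ q U x F ∅ = F U := by
  unfold Yw
  have h : ∀ ω : Set V, ind (sD Γ U x (∅ : Set V)) ω = 1 := fun ω => ind_of_mem fun _ h => h.elim
  simp only [srest_empty, h, mul_one]
  rw [← Finset.sum_mul, hm, one_mul]

/-! ### Star decompositions (site (6): condition on the states of the vertices of `Z`) -/

/-- Star decomposition of `Y_F`: `Y_U(N) = Σ_ω weight(ω) · Y_{U∖Z}((N ∖ Z) ∪ S(ω))` for `Z ⊆ U`, `Z ⊆ N`, `x ∉ Z`.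
[cite: VandenbergHaggstromKahn2005, §1 p. 4, identity (6)] -/
theorem Yw_step {U Z : Finset V} (hZU : Z ⊆ U) {x : V} (hx : x ∉ Z) {N : Set V} (hZN : (↑Z : Set V) ⊆ N)
    (q : V → ℝ) (hm : ∑ ω, weight q ω = 1) (F : Finset V → ℝ) :
    Yw Γ q U x F N = ∑ ω, weight q ω * Yw Γ q (U \ Z) x F ((N \ ↑Z) ∪ sS Γ U Z ω) :=
  setStep_sum hZU hx hZN q hm F

/-- Star decomposition of `X_F`. [cite: VandenbergHaggstromKahn2005, §1 p. 4, identity (6)] -/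
theorem Xw_step {U Z : Finset V} (hZU : Z ⊆ U) {x : V} (hx : x ∉ Z) {N : Set V} (hZN : (↑Z : Set V) ⊆ N)
    (q : V → ℝ) (hm : ∑ ω, weight q ω = 1) (A : Set V) (o v : V) (F : Finset V → ℝ) :
    Xw Γ q U x A o v F N = ∑ ω, weight q ω * Xw Γ q (U \ Z) x A o v F ((N \ ↑Z) ∪ sS Γ U Z ω) :=
  setStep_sum hZU hx hZN q hm fun U' => qav Γ q U' A o v * F U'

/-- Star decomposition of `E_A`: `E_U(N) = Σ_ω weight(ω) · E_{U∖Z}((N ∖ Z) ∪ S(ω))` for `Z ⊆ U`, `Z ⊆ N`, `v ∉ Z`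
(`SiteBHK.step_sum`; the members of `A ∩ Z` are invisible in `G[U ∖ Z]`). [cite: VandenbergHaggstromKahn2005, §1 p. 4, identity (6)] -/
theorem Eav_step {U Z : Finset V} (hZU : Z ⊆ U) {v : V} (hv : v ∉ Z) {A N : Set V}
    (hZN : (↑Z : Set V) ⊆ N) (q : V → ℝ) (hm : ∑ ω, weight q ω = 1) (o : V) :
    Eav Γ q U A o v N = ∑ ω, weight q ω * Eav Γ q (U \ Z) A o v ((N \ ↑Z) ∪ sS Γ U Z ω) := by
  have hZW : (↑Z : Set V) ⊆ A ∪ N := hZN.trans Set.subset_union_right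
  unfold Eav
  rw [step_sum hZU hv hZW q hm (oInd o)]
  refine Finset.sum_congr rfl fun ω _ => ?_
  simp only [blockE, sD_eq_of_agree (U \ Z) v (CovTau.union_diff_agree U Z A N (sS Γ U Z ω))]

/-- Star decomposition of `M_A`. [cite: VandenbergHaggstromKahn2005, §1 p. 4, identity (6)] -/
theorem Mav_step {U Z : Finset V} (hZU : Z ⊆ U) {v : V} (hv : v ∉ Z) {A N : Set V}
    (hZN : (↑Z : Set V) ⊆ N) (q : V → ℝ) (hm : ∑ ω, weight q ω = 1) :
    Mav Γ q U A v N = ∑ ω, weight q ω * Mav Γ q (U \ Z) A v ((N \ ↑Z) ∪ sS Γ U Z ω) := by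
  have hZW : (↑Z : Set V) ⊆ A ∪ N := hZN.trans Set.subset_union_right
  have h := step_sum (Γ := Γ) hZU hv hZW q hm (fun _ => (1 : ℝ))
  simp only [one_mul, blockE] at h
  unfold Mav
  rw [h]
  refine Finset.sum_congr rfl fun ω _ => ?_
  simp only [sD_eq_of_agree (U \ Z) v (CovTau.union_diff_agree U Z A N (sS Γ U Z ω))]

/-- `E_A` only sees `A ∩ U`. [folklore] -/
theorem Eav_eq_inter (q : V → ℝ) (U : Finset V) (A : Set V) (o v : V) (N : Set V) :
    Eav Γ q U A o v N = ∑ ω, weight q ω * (oInd o (sC Γ U v ω) * ind (sD Γ U v ((A ∪ N) ∩ ↑U)) ω) := by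
  unfold Eav; rw [sD_inter_coe U v]

/-- `M_A` only sees `A ∩ U`. [folklore] -/
theorem Mav_eq_inter (q : V → ℝ) (U : Finset V) (A : Set V) (v : V) (N : Set V) :
    Mav Γ q U A v N = ∑ ω, weight q ω * ind (sD Γ U v ((A ∪ N) ∩ ↑U)) ω := by
  unfold Mav; rw [sD_inter_coe U v]

end SiteCovTau

end Summit.CriticalPhenomena.PercolationContinuityZ3.Theorems.Transplant
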